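import Mathlib
import HarnessLib

/-!
# Palasek 2026, §3.1: the barrier functions of the trapping region and Lemma 3.2

Proved real-analysis lemmas (no named facts) transcribing **Definition 3.1** and **Lemma 3.2
(Barrier bounds)** of S. Palasek, *Finite-time blow-up in an elementary model of the 3D
Navier–Stokes equations*, arXiv:2605.13827 (2026), §3.1 — the first block of the discharge of the
named fact `Literature.Analysis.FluidPDE.Palasek2026_viscousBlowup`
(`Literature/Analysis/FluidPDE/PalasekObukhovBlowup.lean`; plan: cell `pub/ns-blowup`,
`lit/PALASEK-FORMALISATION.md` §2–§3).

## What the source prints (§3.1, Def. 3.1 and Lemma 3.2)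

With amplitudes `A_k = N_k^β` (increasing), `δ_k = (N_k/N_{k+1})^{2α}`, `T = c/A₀`,
`t₁ = t₂ = -T`, `t_k = -c A_{k-2}^{-1}` (`k ≥ 3`), the *upper barriers* are `ζ_K(t) =
A_K exp(½ A_{K-1} max{t,t_K})` and, for `1 ≤ k ≤ K-1`, the solution of `ζ_k' = 0` on `[-T,t_k)`,
`ζ_k' = ½ A_{k-1} ζ_k - δ_k ζ_{k+1}²` on `[t_k, 0]`, `ζ_k(0) = A_k`, i.e. (Duhamel, p. 8 of the source)
`ζ_k(t) = A_k e^{½A_{k-1}t} + δ_k ∫_t^0 e^{-½A_{k-1}(s-t)} ζ_{k+1}(s)² ds` on `[t_k,0]`, constant below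
`t_k`; `ζ₀' = -νN₀²ζ₀ - δ₀ζ₁²`, `ζ₀(0) = A₀`. The *lower barriers* are `η₀ ≡ A₀`,
`η_k(t) = A_k exp(-∫_t^0 ζ_{k-1})`. **Lemma 3.2**: `A_k e^{½A_{k-1}max{t,t_k}} ≤ ζ_k(t) ≤
2A_k e^{½A_{k-1}max{t,t_k}}` (`1 ≤ k ≤ K`); `A₀ ≤ ζ₀ ≤ 2A₀`; `η_k ≥ ¾A_k` on `[t_{k+1},0]`;
`η_k(t) ≥ A_k exp(-5A_{k-1}/A_{k-2})` (`k ≥ 2`) — all "after increasing `N₀` if necessary", i.e.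
under the smallness conditions (exp_small) and (ratios) of §3.1.

## Rendering

The lemmas are stated ABSTRACTLY, one induction step at a time, over real parameters
(`Ak, Aprev = A_{k-1}, Anext = A_{k+1}, δk, tk, tk1 = t_{k+1}, …`) with the smallness conditions as
explicit hypotheses in exactly the form the printed proof USES them — e.g. for the upper bound of
`ζ_k` (p. 8, Cases 1–2): (S1) `4 δ_k A_{k+1}² |t_k| e^{A_k t_{k+1}} ≤ ε A_k e^{½A_{k-1}t_k}` and
(S2) `8 δ_k A_{k+1}² ≤ ε A_k²`, `ε ≤ ½` — so that the later blocks (parameter choice, trapping,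
limit) can instantiate them with Palasek's `A_k = N₀^{βb^k}` and his (exp_small)/(ratios). The two
printed cases `t ∈ [t_k,t_{k+1})`, `t ∈ [t_{k+1},0]` are merged by the pointwise inequality
`e^{A max{s,τ}} ≤ e^{Aτ} + e^{As}`. Barriers are DEFINED by the Duhamel formula (backward recursion
in `k` is then plain function iteration) and the ODE of Def. 3.1 is PROVED from it
(`hasDerivAt_zetaMid`), so no ODE existence theory is needed for the barriers.

## Main results

* `zetaTop`, `zetaMid`, `zetaZero`, `eta`: the barrier functions of Def. 3.1.
* `zetaTop_bounds`, `zetaMid_bounds` (the induction step of (z_bound)), `zetaZero_bounds`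
  ((z0_bound)), `eta_ge_three_quarters` ((eta_quarter_bound)): Lemma 3.2 except its last clause.
* The last clause (eta_global_bound), the differential equations of Def. 3.1 and the continuity of
  the barriers are in the sibling file `PalasekObukhovBarrierDynamics.lean`.
-/

open Set Filter Topology MeasureTheory intervalIntegral

namespace Literature.Analysis.FluidPDE

namespace PalasekObukhov

/-! ### Elementary integral facts -/

/-- `∫_{a}^{0} e^{λ s} ds = (1 - e^{λ a})/λ` for `λ ≠ 0`. [folklore] -/
private theorem integral_exp_mul_eq {lam a : ℝ} (hlam : lam ≠ 0) :
    ∫ s in a..0, Real.exp (lam * s) = (1 - Real.exp (lam * a)) / lam := by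
  have h : ∀ x ∈ uIcc a 0, HasDerivAt (fun s => Real.exp (lam * s) / lam) (Real.exp (lam * x)) x := by
    intro x _
    have h1 : HasDerivAt (fun s => lam * s) lam x := by
      simpa using (hasDerivAt_id x).const_mul lam
    have h2 : HasDerivAt (fun s => Real.exp (lam * s)) (Real.exp (lam * x) * lam) x :=
      (Real.hasDerivAt_exp _).comp x h1
    have h3 := h2.div_const lam
    rwa [mul_div_cancel_right₀ _ hlam] at h3
  have hint : IntervalIntegrable (fun s => Real.exp (lam * s)) volume a 0 :=
    (by fun_prop : Continuous fun s => Real.exp (lam * s)).intervalIntegrable _ _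
  rw [integral_eq_sub_of_hasDerivAt h hint]
  simp [sub_div]

/-- For `λ > 0` and `a ≤ 0`: `∫_a^0 e^{λ s} ds ≤ 1/λ`. [folklore] -/
private theorem integral_exp_mul_le {lam a : ℝ} (hlam : 0 < lam) (_ha : a ≤ 0) :
    ∫ s in a..0, Real.exp (lam * s) ≤ 1 / lam := by
  rw [integral_exp_mul_eq hlam.ne']
  apply div_le_div_of_nonneg_right _ hlam.le
  linarith [Real.exp_pos (lam * a)]

/-! ### The barrier profile and the top barrier `ζ_K` -/

/-- The profile `e^{½ A' max{t, τ}}` appearing in (z_bound). [cite: Palasek2026ElementaryModel, §3.1 Lemma 3.2 (z_bound)] -/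
noncomputable def barrierProfile (Aprev tk : ℝ) (t : ℝ) : ℝ :=
  Real.exp (Aprev / 2 * max t tk)

/-- The profile is positive. [cite: Palasek2026ElementaryModel, §3.1 Lemma 3.2] -/
theorem barrierProfile_pos (Aprev tk t : ℝ) : 0 < barrierProfile Aprev tk t :=
  Real.exp_pos _

/-- The top barrier `ζ_K(t) = A_K exp(½ A_{K-1} max{t, t_K})` (explicit formula, proof of Lemma 3.2,
first line). [cite: Palasek2026ElementaryModel, §3.1 Def. 3.1 and Lemma 3.2] -/
noncomputable def zetaTop (AK Aprev tK : ℝ) (t : ℝ) : ℝ :=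
  AK * barrierProfile Aprev tK t

/-- (z_bound) for `k = K`: trivially `A_K E ≤ ζ_K ≤ 2 A_K E` (`A_K ≥ 0`). [cite: Palasek2026ElementaryModel, §3.1 Lemma 3.2 (z_bound), case k = K] -/
theorem zetaTop_bounds {AK : ℝ} (hAK : 0 ≤ AK) (Aprev tK t : ℝ) :
    AK * barrierProfile Aprev tK t ≤ zetaTop AK Aprev tK t ∧
      zetaTop AK Aprev tK t ≤ 2 * AK * barrierProfile Aprev tK t := by
  refine ⟨le_rfl, ?_⟩
  unfold zetaTop
  nlinarith [barrierProfile_pos Aprev tK t]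

/-! ### The Duhamel barriers `ζ_k`, `1 ≤ k ≤ K - 1` -/

/-- The Duhamel integral `𝒩_k(t') = δ_k ∫_{t'}^0 e^{-½A_{k-1}(s-t')} ζ_{k+1}(s)² ds`.
[cite: Palasek2026ElementaryModel, §3.1 proof of Lemma 3.2 (Duhamel formula)] -/
noncomputable def duhamelTerm (Aprev δk : ℝ) (ζnext : ℝ → ℝ) (t' : ℝ) : ℝ :=
  δk * ∫ s in t'..0, Real.exp (-(Aprev / 2) * (s - t')) * ζnext s ^ 2

/-- The barrier `ζ_k` for `1 ≤ k ≤ K-1`: on `[t_k, 0]` it is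
`A_k e^{½A_{k-1}t} + δ_k ∫_t^0 e^{-½A_{k-1}(s-t)} ζ_{k+1}(s)² ds`, and it is constant (`= ζ_k(t_k)`)
for `t ≤ t_k`; both cases at once via `t' = max{t, t_k}`. [cite: Palasek2026ElementaryModel, §3.1 Def. 3.1] -/
noncomputable def zetaMid (Ak Aprev δk tk : ℝ) (ζnext : ℝ → ℝ) (t : ℝ) : ℝ :=
  Ak * Real.exp (Aprev / 2 * max t tk) + duhamelTerm Aprev δk ζnext (max t tk)

/-- The Duhamel term is non-negative on `t' ≤ 0` when `δ_k ≥ 0`. [cite: Palasek2026ElementaryModel, §3.1 proof of Lemma 3.2 ("The lower bound in (z_bound) is immediate")] -/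
theorem duhamelTerm_nonneg {Aprev δk : ℝ} (hδ : 0 ≤ δk) (ζnext : ℝ → ℝ) {t' : ℝ} (ht' : t' ≤ 0) :
    0 ≤ duhamelTerm Aprev δk ζnext t' := by
  unfold duhamelTerm
  refine mul_nonneg hδ (integral_nonneg ht' fun s _ => ?_)
  positivity

/-- **Lemma 3.2, (z_bound), induction step.** Let `0 < A_{k-1} ≤ A_k`, `δ_k ≥ 0`,
`t_k ≤ t_{k+1} ≤ 0`, and suppose the next barrier obeys `0 ≤ ζ_{k+1}(s) ≤ 2A_{k+1}e^{½A_k max{s,t_{k+1}}}`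
and is continuous on `[t_k, 0]`. Under the two smallness conditions used on p. 8 of the source,
(S1) `4 δ_k A_{k+1}² |t_k| e^{A_k t_{k+1}} ≤ ε A_k e^{½ A_{k-1} t_k}` (Case 1, first term) and
(S2) `8 δ_k A_{k+1}² ≤ ε A_k²` (the `δ_kA_{k+1}²/A_k²` term), with `ε ≤ ½`, the barrier `ζ_k`
satisfies `A_k e^{½A_{k-1}max{t,t_k}} ≤ ζ_k(t) ≤ 2A_k e^{½A_{k-1}max{t,t_k}}` for every `t ≤ 0`.
[cite: Palasek2026ElementaryModel, §3.1 Lemma 3.2 (z_bound), Cases 1–2 of the proof] -/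
theorem zetaMid_bounds {Ak Aprev Anext δk tk tk1 ε : ℝ} {ζnext : ℝ → ℝ}
    (hAprev : 0 < Aprev) (hA : Aprev ≤ Ak) (hδ : 0 ≤ δk)
    (htk : tk ≤ tk1) (htk1 : tk1 ≤ 0) (hε : ε ≤ 1 / 2)
    (hcont : ContinuousOn ζnext (Icc tk 0))
    (hnext : ∀ s ∈ Icc tk 0, 0 ≤ ζnext s ∧ ζnext s ≤ 2 * Anext * barrierProfile Ak tk1 s)
    (hS1 : 4 * δk * Anext ^ 2 * (-tk) * Real.exp (Ak * tk1) ≤ ε * Ak * Real.exp (Aprev / 2 * tk))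
    (hS2 : 8 * δk * Anext ^ 2 ≤ ε * Ak ^ 2) {t : ℝ} (ht : t ≤ 0) :
    Ak * barrierProfile Aprev tk t ≤ zetaMid Ak Aprev δk tk ζnext t ∧
      zetaMid Ak Aprev δk tk ζnext t ≤ 2 * Ak * barrierProfile Aprev tk t := by
  have hAk : 0 < Ak := hAprev.trans_le hA
  set t' := max t tk with ht'def
  have ht'0 : t' ≤ 0 := max_le ht (htk.trans htk1)
  have ht'k : tk ≤ t' := le_max_right _ _
  have hprof : barrierProfile Aprev tk t = Real.exp (Aprev / 2 * t') := rfl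
  have hz : zetaMid Ak Aprev δk tk ζnext t =
      Ak * Real.exp (Aprev / 2 * t') + duhamelTerm Aprev δk ζnext t' := rfl
  constructor
  · -- lower bound: the Duhamel term is non-negative
    rw [hprof, hz]
    have := duhamelTerm_nonneg (Aprev := Aprev) hδ ζnext ht'0
    linarith
  · rw [hprof, hz]
    -- it suffices to bound the Duhamel term by `2 ε A_k e^{½ A_{k-1} t'}`
    suffices hN : duhamelTerm Aprev δk ζnext t' ≤ 2 * ε * Ak * Real.exp (Aprev / 2 * t') by
      have hE := Real.exp_pos (Aprev / 2 * t')
      have hεE : ε * (Ak * Real.exp (Aprev / 2 * t')) ≤ 1 / 2 * (Ak * Real.exp (Aprev / 2 * t')) :=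
        mul_le_mul_of_nonneg_right hε (mul_pos hAk hE).le
      nlinarith
    -- pointwise bound on the integrand
    have hsub : Icc t' 0 ⊆ Icc tk 0 := Icc_subset_Icc ht'k le_rfl
    set g : ℝ → ℝ := fun s => Real.exp (-(Aprev / 2) * (s - t')) * ζnext s ^ 2 with hg
    set h₁ : ℝ → ℝ := fun _ => 4 * Anext ^ 2 * Real.exp (Ak * tk1) with hh₁
    set h₂ : ℝ → ℝ := fun s => 4 * Anext ^ 2 * Real.exp (Aprev / 2 * t') *
      Real.exp ((Ak - Aprev / 2) * s) with hh₂
    have hpt : ∀ s ∈ Icc t' 0, g s ≤ h₁ s + h₂ s := by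
      intro s hs
      have hs' : s ∈ Icc tk 0 := hsub hs
      obtain ⟨h0, hle⟩ := hnext s hs'
      -- `ζnext s ^ 2 ≤ 4 Anext² e^{A_k max{s, t_{k+1}}} ≤ 4 Anext² (e^{A_k t_{k+1}} + e^{A_k s})`
      have hsq : ζnext s ^ 2 ≤ (2 * Anext * barrierProfile Ak tk1 s) ^ 2 :=
        pow_le_pow_left₀ h0 hle 2
      have hprof2 : (barrierProfile Ak tk1 s) ^ 2 = Real.exp (Ak * max s tk1) := by
        unfold barrierProfile
        rw [sq, ← Real.exp_add]
        congr 1; ring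
      have hmax : Real.exp (Ak * max s tk1) ≤ Real.exp (Ak * tk1) + Real.exp (Ak * s) := by
        rcases le_total s tk1 with hcase | hcase
        · rw [max_eq_right hcase]; linarith [Real.exp_pos (Ak * s)]
        · rw [max_eq_left hcase]; linarith [Real.exp_pos (Ak * tk1)]
      -- the exponential weight is `≤ 1` and equals `e^{½A' t'} e^{-½A' s}`
      have hw1 : Real.exp (-(Aprev / 2) * (s - t')) ≤ 1 := by
        rw [Real.exp_le_one_iff]
        have : t' ≤ s := hs.1
        nlinarith
      have hw0 : 0 ≤ Real.exp (-(Aprev / 2) * (s - t')) := (Real.exp_pos _).le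
      have hweq : Real.exp (-(Aprev / 2) * (s - t')) * Real.exp (Ak * s) =
          Real.exp (Aprev / 2 * t') * Real.exp ((Ak - Aprev / 2) * s) := by
        rw [← Real.exp_add, ← Real.exp_add]; congr 1; ring
      calc g s = Real.exp (-(Aprev / 2) * (s - t')) * ζnext s ^ 2 := rfl
        _ ≤ Real.exp (-(Aprev / 2) * (s - t')) * (4 * Anext ^ 2 * Real.exp (Ak * max s tk1)) := by
            apply mul_le_mul_of_nonneg_left _ hw0
            calc ζnext s ^ 2 ≤ (2 * Anext * barrierProfile Ak tk1 s) ^ 2 := hsq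
              _ = 4 * Anext ^ 2 * Real.exp (Ak * max s tk1) := by rw [mul_pow, ← hprof2]; ring
        _ ≤ Real.exp (-(Aprev / 2) * (s - t')) * (4 * Anext ^ 2 * (Real.exp (Ak * tk1) + Real.exp (Ak * s))) := by
            apply mul_le_mul_of_nonneg_left _ hw0
            exact mul_le_mul_of_nonneg_left hmax (by positivity)
        _ = (Real.exp (-(Aprev / 2) * (s - t'))) * (4 * Anext ^ 2 * Real.exp (Ak * tk1)) +
              4 * Anext ^ 2 * (Real.exp (-(Aprev / 2) * (s - t')) * Real.exp (Ak * s)) := by ring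
        _ ≤ 1 * (4 * Anext ^ 2 * Real.exp (Ak * tk1)) +
              4 * Anext ^ 2 * (Real.exp (-(Aprev / 2) * (s - t')) * Real.exp (Ak * s)) := by
            gcongr
        _ = h₁ s + h₂ s := by rw [hweq, hh₁, hh₂]; ring
    -- integrability
    have hcontg : ContinuousOn g (Icc t' 0) := by
      rw [hg]
      apply ContinuousOn.mul
      · exact (by fun_prop : Continuous fun s => Real.exp (-(Aprev / 2) * (s - t'))).continuousOn
      · exact (hcont.mono hsub).pow 2
    have hig : IntervalIntegrable g volume t' 0 :=
      (hcontg.mono (uIcc_of_le ht'0).le).intervalIntegrable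
    have hih₁ : IntervalIntegrable h₁ volume t' 0 := by
      rw [hh₁]; exact intervalIntegrable_const
    have hih₂ : IntervalIntegrable h₂ volume t' 0 := by
      rw [hh₂]
      exact (by fun_prop : Continuous fun s => 4 * Anext ^ 2 * Real.exp (Aprev / 2 * t') *
        Real.exp ((Ak - Aprev / 2) * s)).intervalIntegrable _ _
    -- integrate
    have hint_le : ∫ s in t'..0, g s ≤ ∫ s in t'..0, (h₁ s + h₂ s) :=
      integral_mono_on ht'0 hig (hih₁.add hih₂) hpt
    rw [integral_add hih₁ hih₂] at hint_le
    -- first term: `∫_{t'}^0 h₁ = 4 Anext² e^{A_k t_{k+1}} (-t') ≤ 4 Anext² e^{A_k t_{k+1}} |t_k|`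
    have hI1 : ∫ s in t'..0, h₁ s ≤ 4 * Anext ^ 2 * Real.exp (Ak * tk1) * (-tk) := by
      simp only [hh₁, intervalIntegral.integral_const, smul_eq_mul]
      have : (0 - t') ≤ -tk := by linarith
      have h4 : 0 ≤ 4 * Anext ^ 2 * Real.exp (Ak * tk1) := by positivity
      nlinarith
    -- second term: closed form of the exponential integral
    have hlam : 0 < Ak - Aprev / 2 := by linarith
    have hI2 : ∫ s in t'..0, h₂ s ≤ 4 * Anext ^ 2 * Real.exp (Aprev / 2 * t') * (2 / Ak) := by
      simp only [hh₂]
      rw [intervalIntegral.integral_const_mul]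
      apply mul_le_mul_of_nonneg_left _ (by positivity)
      calc ∫ s in t'..0, Real.exp ((Ak - Aprev / 2) * s) ≤ 1 / (Ak - Aprev / 2) :=
            integral_exp_mul_le hlam ht'0
        _ ≤ 2 / Ak := by
            rw [div_le_div_iff₀ hlam hAk]; nlinarith
    -- assemble with (S1), (S2)
    have hexp_mono : Real.exp (Aprev / 2 * tk) ≤ Real.exp (Aprev / 2 * t') :=
      Real.exp_le_exp.mpr (by nlinarith)
    have hT1 : δk * (4 * Anext ^ 2 * Real.exp (Ak * tk1) * (-tk)) ≤ ε * Ak * Real.exp (Aprev / 2 * t') := by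
      calc δk * (4 * Anext ^ 2 * Real.exp (Ak * tk1) * (-tk))
          = 4 * δk * Anext ^ 2 * (-tk) * Real.exp (Ak * tk1) := by ring
        _ ≤ ε * Ak * Real.exp (Aprev / 2 * tk) := hS1
        _ ≤ ε * Ak * Real.exp (Aprev / 2 * t') := by
            have hε0 : 0 ≤ ε := by
              -- from (S2): `ε A_k² ≥ 8 δ_k A_{k+1}² ≥ 0` with `A_k > 0`
              rcases lt_or_ge ε 0 with hneg | hge
              · have h1 : ε * Ak ^ 2 < 0 := mul_neg_of_neg_of_pos hneg (by positivity)
                have h2 : (0 : ℝ) ≤ 8 * δk * Anext ^ 2 := by positivity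
                linarith
              · exact hge
            exact mul_le_mul_of_nonneg_left hexp_mono (mul_nonneg hε0 hAk.le)
    have hT2 : δk * (4 * Anext ^ 2 * Real.exp (Aprev / 2 * t') * (2 / Ak)) ≤
        ε * Ak * Real.exp (Aprev / 2 * t') := by
      have hE := Real.exp_pos (Aprev / 2 * t')
      have h8 : 8 * δk * Anext ^ 2 / Ak ≤ ε * Ak := by
        rw [div_le_iff₀ hAk]; nlinarith [hS2]
      calc δk * (4 * Anext ^ 2 * Real.exp (Aprev / 2 * t') * (2 / Ak))
          = (8 * δk * Anext ^ 2 / Ak) * Real.exp (Aprev / 2 * t') := by ring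
        _ ≤ ε * Ak * Real.exp (Aprev / 2 * t') := mul_le_mul_of_nonneg_right h8 hE.le
    unfold duhamelTerm
    calc δk * ∫ s in t'..0, g s ≤ δk * ((∫ s in t'..0, h₁ s) + ∫ s in t'..0, h₂ s) :=
          mul_le_mul_of_nonneg_left hint_le hδ
      _ ≤ δk * (4 * Anext ^ 2 * Real.exp (Ak * tk1) * (-tk)) +
            δk * (4 * Anext ^ 2 * Real.exp (Aprev / 2 * t') * (2 / Ak)) := by
          rw [mul_add]; gcongr
      _ ≤ ε * Ak * Real.exp (Aprev / 2 * t') + ε * Ak * Real.exp (Aprev / 2 * t') := add_le_add hT1 hT2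
      _ = 2 * ε * Ak * Real.exp (Aprev / 2 * t') := by ring

/-! ### The viscous bottom barrier `ζ₀` -/

/-- The bottom barrier `ζ₀` (Def. 3.1): the solution of `ζ₀' = -μ ζ₀ - δ₀ ζ₁²`, `ζ₀(0) = A₀`
(`μ = νN₀² ≥ 0`; `μ = 0` in the inviscid case), written by Duhamel backward from `t = 0`:
`ζ₀(t) = e^{-μt} A₀ + δ₀ ∫_t^0 e^{μ(s-t)} ζ₁(s)² ds`. [cite: Palasek2026ElementaryModel, §3.1 Def. 3.1 and proof of (z0_bound)] -/
noncomputable def zetaZero (μ A0 δ0 : ℝ) (ζone : ℝ → ℝ) (t : ℝ) : ℝ :=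
  Real.exp (-(μ * t)) * A0 + δ0 * ∫ s in t..0, Real.exp (μ * (s - t)) * ζone s ^ 2

/-- **Lemma 3.2, (z0_bound):** `A₀ ≤ ζ₀(t) ≤ 2A₀` on `[-T, 0]`, given the next barrier's bound
`0 ≤ ζ₁(s) ≤ 2A₁e^{½A₀s}` there ((z_bound) for `k = 1`, where `max{s,t₁} = s` as `t₁ = -T`) and the two
smallness conditions used in the printed proof (p. 9, first display): (V1) `e^{μT} ≤ 3/2`
(there: `e^{νcN₀^{2-β}}` with `cN₀²/A₀ ≤ 1/10`) and (V2) `12 δ₀A₁² ≤ A₀²` (there: `4δ₀A₁²/A₀`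
small). [cite: Palasek2026ElementaryModel, §3.1 Lemma 3.2 (z0_bound) and its proof] -/
theorem zetaZero_bounds {μ A0 A1 δ0 T : ℝ} {ζone : ℝ → ℝ} (hμ : 0 ≤ μ) (hA0 : 0 < A0)
    (hδ : 0 ≤ δ0) (hcont : ContinuousOn ζone (Icc (-T) 0))
    (hone : ∀ s ∈ Icc (-T) 0, 0 ≤ ζone s ∧ ζone s ≤ 2 * A1 * Real.exp (A0 / 2 * s))
    (hV1 : Real.exp (μ * T) ≤ 3 / 2) (hV2 : 12 * δ0 * A1 ^ 2 ≤ A0 ^ 2)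
    {t : ℝ} (ht : t ∈ Icc (-T) 0) :
    A0 ≤ zetaZero μ A0 δ0 ζone t ∧ zetaZero μ A0 δ0 ζone t ≤ 2 * A0 := by
  obtain ⟨htT, ht0⟩ := ht
  have hsub : Icc t 0 ⊆ Icc (-T) 0 := Icc_subset_Icc htT le_rfl
  -- the homogeneous part: `1 ≤ e^{-μ t} ≤ e^{μ T}`
  have hexp1 : 1 ≤ Real.exp (-(μ * t)) := Real.one_le_exp (by nlinarith)
  have hexpT : Real.exp (-(μ * t)) ≤ Real.exp (μ * T) := Real.exp_le_exp.mpr (by nlinarith)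
  -- the integrand and its bound
  set g : ℝ → ℝ := fun s => Real.exp (μ * (s - t)) * ζone s ^ 2 with hg
  set h : ℝ → ℝ := fun s => Real.exp (μ * T) * (4 * A1 ^ 2) * Real.exp (A0 * s) with hh
  have hpt : ∀ s ∈ Icc t 0, g s ≤ h s := by
    intro s hs
    obtain ⟨h0, hle⟩ := hone s (hsub hs)
    have hsq : ζone s ^ 2 ≤ (2 * A1 * Real.exp (A0 / 2 * s)) ^ 2 := pow_le_pow_left₀ h0 hle 2
    have hsq' : (2 * A1 * Real.exp (A0 / 2 * s)) ^ 2 = 4 * A1 ^ 2 * Real.exp (A0 * s) := by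
      rw [mul_pow, mul_pow, sq (Real.exp _), ← Real.exp_add]; ring_nf
    have hw : Real.exp (μ * (s - t)) ≤ Real.exp (μ * T) := Real.exp_le_exp.mpr (by nlinarith [hs.2])
    calc g s = Real.exp (μ * (s - t)) * ζone s ^ 2 := rfl
      _ ≤ Real.exp (μ * T) * (4 * A1 ^ 2 * Real.exp (A0 * s)) := by
          apply mul_le_mul hw (hsq.trans_eq hsq') (by positivity) (by positivity)
      _ = h s := by rw [hh]; ring
  have hgnonneg : ∀ s ∈ Icc t 0, 0 ≤ g s := fun s _ => by positivity
  have hcontg : ContinuousOn g (Icc t 0) := by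
    rw [hg]
    apply ContinuousOn.mul
    · exact (by fun_prop : Continuous fun s => Real.exp (μ * (s - t))).continuousOn
    · exact (hcont.mono hsub).pow 2
  have hig : IntervalIntegrable g volume t 0 := (hcontg.mono (uIcc_of_le ht0).le).intervalIntegrable
  have hih : IntervalIntegrable h volume t 0 := by
    rw [hh]
    exact (by fun_prop : Continuous fun s => Real.exp (μ * T) * (4 * A1 ^ 2) *
      Real.exp (A0 * s)).intervalIntegrable _ _
  have hz : zetaZero μ A0 δ0 ζone t = Real.exp (-(μ * t)) * A0 + δ0 * ∫ s in t..0, g s := rfl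
  constructor
  · rw [hz]
    have hI : 0 ≤ ∫ s in t..0, g s := integral_nonneg ht0 hgnonneg
    nlinarith [mul_nonneg hδ hI]
  · rw [hz]
    have hI : ∫ s in t..0, g s ≤ Real.exp (μ * T) * (4 * A1 ^ 2) * (1 / A0) := by
      calc ∫ s in t..0, g s ≤ ∫ s in t..0, h s := integral_mono_on ht0 hig hih hpt
        _ = Real.exp (μ * T) * (4 * A1 ^ 2) * ∫ s in t..0, Real.exp (A0 * s) := by
            simp only [hh]; rw [intervalIntegral.integral_const_mul]
        _ ≤ Real.exp (μ * T) * (4 * A1 ^ 2) * (1 / A0) :=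
            mul_le_mul_of_nonneg_left (integral_exp_mul_le hA0 ht0) (by positivity)
    -- `ζ₀ ≤ e^{μT}(A₀ + 4δ₀A₁²/A₀) ≤ (3/2)(A₀ + A₀/3) = 2A₀`
    have h1 : Real.exp (-(μ * t)) * A0 ≤ 3 / 2 * A0 := by nlinarith
    have h2 : δ0 * (Real.exp (μ * T) * (4 * A1 ^ 2) * (1 / A0)) ≤ 1 / 2 * A0 := by
      have h4 : 4 * δ0 * A1 ^ 2 * (1 / A0) ≤ A0 / 3 := by
        rw [show 4 * δ0 * A1 ^ 2 * (1 / A0) = (4 * δ0 * A1 ^ 2) / A0 by ring, div_le_iff₀ hA0]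
        nlinarith
      calc δ0 * (Real.exp (μ * T) * (4 * A1 ^ 2) * (1 / A0))
          = Real.exp (μ * T) * (4 * δ0 * A1 ^ 2 * (1 / A0)) := by ring
        _ ≤ 3 / 2 * (A0 / 3) := mul_le_mul hV1 h4 (by positivity) (by positivity)
        _ = 1 / 2 * A0 := by ring
    nlinarith [mul_le_mul_of_nonneg_left hI hδ]

/-! ### The lower barriers `η_k` -/

/-- The lower barrier `η_k(t) = A_k exp(-∫_t^0 ζ_{k-1}(s) ds)` (Def. 3.1; `η₀ ≡ A₀` is the case of a
vanishing previous barrier). [cite: Palasek2026ElementaryModel, §3.1 Def. 3.1] -/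
noncomputable def eta (Ak : ℝ) (ζprev : ℝ → ℝ) (t : ℝ) : ℝ :=
  Ak * Real.exp (-∫ s in t..0, ζprev s)

/-- `η_k ≤ A_k` whenever the previous barrier is non-negative on `[t, 0]` (so `ℛ_K` is a genuine
rectangle below the terminal data). [cite: Palasek2026ElementaryModel, §3.1 Def. 3.1] -/
theorem eta_le {Ak : ℝ} (hAk : 0 ≤ Ak) {ζprev : ℝ → ℝ} {t : ℝ} (ht : t ≤ 0)
    (hnn : ∀ s ∈ Icc t 0, 0 ≤ ζprev s) : eta Ak ζprev t ≤ Ak := by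
  unfold eta
  have hI : 0 ≤ ∫ s in t..0, ζprev s := integral_nonneg ht hnn
  have : Real.exp (-∫ s in t..0, ζprev s) ≤ 1 := Real.exp_le_one_iff.mpr (by linarith)
  nlinarith

/-- Monotone dependence of `η_k` on a bound for `∫_t^0 ζ_{k-1}`: if `∫_t^0 ζ_{k-1} ≤ M` then
`η_k(t) ≥ A_k e^{-M}`. [cite: Palasek2026ElementaryModel, §3.1 proof of Lemma 3.2 (eta bounds)] -/
theorem eta_ge_of_integral_le {Ak M : ℝ} (hAk : 0 ≤ Ak) {ζprev : ℝ → ℝ} {t : ℝ}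
    (hM : ∫ s in t..0, ζprev s ≤ M) : Ak * Real.exp (-M) ≤ eta Ak ζprev t := by
  unfold eta
  exact mul_le_mul_of_nonneg_left (Real.exp_le_exp.mpr (by linarith)) hAk

/-- **Lemma 3.2, (eta_quarter_bound):** if the previous barrier obeys the crude bound
`0 ≤ ζ_{k-1} ≤ 2A_{k-1}` on `[t, 0]` (a consequence of (z_bound)/(z0_bound), since the profile is `≤ 1`
for `t ≤ 0`) and `t ≥ t_{k+1} = -c/A_{k-1}`, then `∫_t^0 ζ_{k-1} ≤ 2c`, hence `η_k(t) ≥ A_k e^{-2c} ≥ ¾A_k`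
as soon as `e^{-2c} ≥ 3/4` ("by the choice of `c > 0`"). [cite: Palasek2026ElementaryModel, §3.1 Lemma 3.2 (eta_quarter_bound) and its proof] -/
theorem eta_ge_three_quarters {Ak Aprev c : ℝ} (hAk : 0 ≤ Ak) (hAprev : 0 < Aprev)
    (hc : 3 / 4 ≤ Real.exp (-(2 * c))) {ζprev : ℝ → ℝ} {t : ℝ} (ht0 : t ≤ 0)
    (htk1 : -(c / Aprev) ≤ t) (hint : IntervalIntegrable ζprev volume t 0)
    (hprev : ∀ s ∈ Icc t 0, 0 ≤ ζprev s ∧ ζprev s ≤ 2 * Aprev) :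
    3 / 4 * Ak ≤ eta Ak ζprev t := by
  have hI : ∫ s in t..0, ζprev s ≤ 2 * c := by
    calc ∫ s in t..0, ζprev s ≤ ∫ s in t..0, (2 * Aprev : ℝ) :=
          integral_mono_on ht0 hint intervalIntegrable_const fun s hs => (hprev s hs).2
      _ = (0 - t) * (2 * Aprev) := by rw [intervalIntegral.integral_const, smul_eq_mul]
      _ ≤ c / Aprev * (2 * Aprev) := by nlinarith
      _ = 2 * c := by field_simp
  calc 3 / 4 * Ak ≤ Ak * Real.exp (-(2 * c)) := by nlinarith
    _ ≤ eta Ak ζprev t := eta_ge_of_integral_le hAk hI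

end PalasekObukhov

end Literature.Analysis.FluidPDE
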